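import Literature.Analysis.FluidPDE.OseenBoundedFieldsContinuity
import HarnessLib

/-!
# Pointwise time continuity of the Oseen Duhamel term of bounded fields, uniformly in the bound

Analysis/FluidPDE support file (everything proved, no definitions) on the discharge path of
`Literature.Analysis.FluidPDE.KNSS2009_typeI_rate_vertex` (`KNSSTypeIRateCore.lean`; Koch–
Nadirashvili–Seregin–Šverák 2009, proof of Theorem 6.2, last paragraph, arXiv:0709.3599 p. 13).
The vertex estimate there needs that the Duhamel term `B^ν_s(u,v)(t)(x) = oseenDuhamel ν s u v t x`
fed by fields bounded by `M` is continuous in `t` at a *fixed point* `x`, with a modulus of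
continuity depending on the fields only through `M` (so that it is uniform along the blow-up
sequence off the cylinders `𝒞_k`, where `|w⁽ᵏ⁾| ≤ K`). This is the `L^∞` form of the linear
estimate (3.10) of KNSS (`‖u‖_{C^α_par} ≤ C‖f‖_{L^∞}` for the mild solution of the Stokes problem
with right-hand side `∂_k f_k`), in the qualitative form that the printed argument uses; the tree
already has the `L³`-valued version (`continuousInLpOn_oseenDuhamel_three`,
`OseenBoundedFieldsContinuity.lean`), and the present file runs the same proof pointwise:

* `enorm_oseenDuhamel_increment_le` — for `s < t ≤ t' ≤ T` and fields bounded by `M` on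
  `(s, T) × E`, the pointwise increment of the early piece is controlled by the kernel increment:
  `‖B^ν_s(1_{<t}u,1_{<t}v)(t')(x) - B^ν_s(u,v)(t)(x)‖ ≤ M² ∫_{(s,t)}∫ ∑ᵢⱼ ‖K(ν(t'-τ),z)[eᵢ,eⱼ] -
  K(ν(t-τ),z)[eᵢ,eⱼ]‖ dz dτ` (Fubini for the absolutely convergent Duhamel integrals, the
  orthonormal-basis majorant `norm_oseenKernel_sub_le_sum_basis`, translation invariance in `z`);
* `exists_forall_norm_oseenDuhamel_sub_le` — **uniform modulus of continuity**: for `ν > 0`,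
  `S > 0`, `M ≥ 0` and `ε > 0` there is `δ > 0` such that for *all* fields `u, v` measurable and
  bounded by `M` on a slab `(s, T) × E` with `T - s ≤ S`, all `s ≤ t ≤ t' ≤ T` with `t' - t ≤ δ`
  and all `x`, `‖B^ν_s(u,v)(t')(x) - B^ν_s(u,v)(t)(x)‖ ≤ ε`. Proof: split at `t`
  (`oseenDuhamel_eq_indicator_add`); the late piece `B^ν_t(u,v)(t')` is `O(M²√(t'-t))`
  (`exists_norm_oseenDuhamel_bounded_le`), the early increment is at most `M² Ω_S(t'-t)` with
  `Ω_S(h) = ∫_{(0,S)}∫∑ᵢⱼ‖K(ν(σ+h))[eᵢ,eⱼ] - K(νσ)[eᵢ,eⱼ]‖ → 0` as `h → 0⁺`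
  (`tendsto_lintegral_sum_norm_oseenKernel_sub`, `OseenKernelTimeContinuity.lean`).

## Mathlib / tree search

Tree: `oseenDuhamel_eq_indicator_add`, `oseenDuhamel_indicator_Iio`, `setLIntegral_Ioo_reflect_sub`,
`oseenDuhamel_eq_zero_of_le` (`OseenBoundedFieldsContinuity`); `integrable_oseenKernel_duhamel_bounded`,
`exists_norm_oseenDuhamel_bounded_le` (`NSBoundedMildOseenDuhamel`); `norm_oseenKernel_sub_le_sum_basis`,
`tendsto_lintegral_sum_norm_oseenKernel_sub` (`OseenKernelTimeContinuity`);
`volume_restrict_prod_univ_eq_prod` (`KatoUniquenessDual`). `lean search 'oseenDuhamel.*sub_le|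
modulus.*oseenDuhamel'`: only the `L³` statements. Mathlib: `Integrable.prod_right_ae`,
`Integrable.integral_prod_left`, `enorm_integral_le_lintegral_enorm`, `lintegral_sub_left_eq_self`,
`mem_nhdsGT_iff_exists_Ioo_subset`.

## References

* G. Koch, N. Nadirashvili, G. Seregin, V. Šverák, *Liouville theorems for the Navier–Stokes
  equations and applications*, Acta Math. 203 (2009) 83–105 = arXiv:0709.3599, §3 (3.10) (p. 6)
  and the proof of Thm 6.2, last paragraph (p. 13). [KochNadirashviliSereginSverak2009]
* P. G. Lemarié-Rieusset, *The Navier–Stokes Problem in the 21st Century*, CRC Press 2016,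
  proof of Thm. 7.5 (continuity in time of `B(F,G)`). [LemarieRieusset2016]
-/

noncomputable section

open MeasureTheory TopologicalSpace Set Function Filter Metric InnerProductSpace
open _root_.Topology
open scoped ENNReal NNReal RealInnerProductSpace

namespace Literature.Analysis.FluidPDE

variable {E : Type*} [NormedAddCommGroup E] [InnerProductSpace ℝ E] [FiniteDimensional ℝ E]
  [MeasurableSpace E] [BorelSpace E]

/-! ### The pointwise increment of the early piece -/

section Increment

variable {ν s T M : ℝ} {u v : ℝ → E → E}

/-- **The pointwise increment of the Duhamel term from the kernel increment.** For `ν > 0`,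
fields `u, v` measurable and bounded by `M ≥ 0` on `(s, T) × E`, `s < t ≤ t' ≤ T` and every `x`,
`‖B^ν_s(1_{<t}u, 1_{<t}v)(t')(x) - B^ν_s(u,v)(t)(x)‖ₑ ≤ M² ∫_{(s,t)} ∫ ∑ᵢⱼ ‖K(ν(t'-τ), z)[eᵢ,eⱼ] -
K(ν(t-τ), z)[eᵢ,eⱼ]‖ dz dτ` with `e = stdOrthonormalBasis ℝ E` (both Duhamel integrals converge
absolutely, so their difference is the iterated integral of the kernel increment against
`u ⊗ v`, which is majorised slot-wise through the basis). The pointwise form of the `L³`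
increment estimate `eLpNorm_oseenDuhamel_increment_le`. [folklore] -/
theorem enorm_oseenDuhamel_increment_le (hν : 0 < ν)
    (hu : AEStronglyMeasurable (uncurry u) ((volume : Measure (ℝ × E)).restrict (Ioo s T ×ˢ univ)))
    (hv : AEStronglyMeasurable (uncurry v) ((volume : Measure (ℝ × E)).restrict (Ioo s T ×ˢ univ)))
    (hM : 0 ≤ M) (huM : ∀ τ ∈ Ioo s T, ∀ y, ‖u τ y‖ ≤ M) (hvM : ∀ τ ∈ Ioo s T, ∀ y, ‖v τ y‖ ≤ M)
    {t t' : ℝ} (hst : s < t) (htt' : t ≤ t') (ht'T : t' ≤ T) (x : E) :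
    ‖oseenDuhamel ν s ((Iio t).indicator u) ((Iio t).indicator v) t' x - oseenDuhamel ν s u v t x‖ₑ ≤
      ENNReal.ofReal (M ^ 2) * ∫⁻ τ in Ioo s t, ∫⁻ z, ENNReal.ofReal (∑ i, ∑ j,
        ‖oseenKernel (ν * (t' - τ)) z (stdOrthonormalBasis ℝ E i) (stdOrthonormalBasis ℝ E j) -
          oseenKernel (ν * (t - τ)) z (stdOrthonormalBasis ℝ E i) (stdOrthonormalBasis ℝ E j)‖) := by
  set e := stdOrthonormalBasis ℝ E with he
  set m : ℝ → E → ℝ := fun τ z => ∑ i, ∑ j,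
    ‖oseenKernel (ν * (t' - τ)) z (e i) (e j) - oseenKernel (ν * (t - τ)) z (e i) (e j)‖ with hm
  -- the two integrands
  set f : ℝ × E → E := fun p => oseenKernel (ν * (t' - p.1)) (x - p.2) (u p.1 p.2) (v p.1 p.2)
    with hf
  set g : ℝ × E → E := fun p => oseenKernel (ν * (t - p.1)) (x - p.2) (u p.1 p.2) (v p.1 p.2)
    with hg
  have htT : t ≤ T := htt'.trans ht'T
  have hst' : s < t' := hst.trans_le htt'
  -- integrability on `(s, t) × E`
  have hgi : Integrable g ((volume.restrict (Ioo s t)).prod (volume : Measure E)) := by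
    have h := integrable_oseenKernel_duhamel_bounded hν hu hv hM huM hvM hst htT x
    rwa [volume_restrict_prod_univ_eq_prod] at h
  have hfi : Integrable f ((volume.restrict (Ioo s t)).prod (volume : Measure E)) := by
    have h := integrable_oseenKernel_duhamel_bounded hν hu hv hM huM hvM hst' ht'T x
    have hsub : Ioo s t ×ˢ (univ : Set E) ⊆ Ioo s t' ×ˢ univ :=
      prod_mono (Ioo_subset_Ioo_right htt') subset_rfl
    have h' := h.mono_measure (Measure.restrict_mono hsub le_rfl)
    rwa [volume_restrict_prod_univ_eq_prod] at h'
  -- the two Duhamel terms as iterated integrals over `(s, t)`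
  have h1 : oseenDuhamel ν s ((Iio t).indicator u) ((Iio t).indicator v) t' x =
      ∫ τ in Ioo s t, ∫ y, f (τ, y) := oseenDuhamel_indicator_Iio htt' x
  have h2 : oseenDuhamel ν s u v t x = ∫ τ in Ioo s t, ∫ y, g (τ, y) := oseenDuhamel_apply _ _ _ _ _ _
  have hsub : (∫ τ in Ioo s t, ∫ y, f (τ, y)) - ∫ τ in Ioo s t, ∫ y, g (τ, y) =
      ∫ τ in Ioo s t, ((∫ y, f (τ, y)) - ∫ y, g (τ, y)) :=
    (integral_sub hfi.integral_prod_left hgi.integral_prod_left).symm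
  have hae : ∀ᵐ τ ∂(volume.restrict (Ioo s t)),
      ((∫ y, f (τ, y)) - ∫ y, g (τ, y)) = ∫ y, (f (τ, y) - g (τ, y)) := by
    filter_upwards [hfi.prod_right_ae, hgi.prod_right_ae] with τ hf1 hg1
    exact (integral_sub hf1 hg1).symm
  -- the pointwise majorant
  have hpt : ∀ τ ∈ Ioo s t, ∀ y, ‖f (τ, y) - g (τ, y)‖ₑ ≤
      ENNReal.ofReal (M ^ 2) * ENNReal.ofReal (m τ (x - y)) := by
    intro τ hτ y
    have hτ' : τ ∈ Ioo s T := ⟨hτ.1, hτ.2.trans_le htT⟩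
    rw [← ofReal_norm, ← ENNReal.ofReal_mul (sq_nonneg M)]
    refine ENNReal.ofReal_le_ofReal ?_
    have hm0 : 0 ≤ m τ (x - y) :=
      Finset.sum_nonneg fun i _ => Finset.sum_nonneg fun j _ => norm_nonneg _
    calc ‖f (τ, y) - g (τ, y)‖
        ≤ m τ (x - y) * ‖u τ y‖ * ‖v τ y‖ := norm_oseenKernel_sub_le_sum_basis e _ _ _ _ _
      _ ≤ m τ (x - y) * M * M :=
          mul_le_mul (mul_le_mul_of_nonneg_left (huM τ hτ' y) hm0) (hvM τ hτ' y) (norm_nonneg _)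
            (mul_nonneg hm0 hM)
      _ = M ^ 2 * m τ (x - y) := by ring
  rw [h1, h2, hsub]
  calc ‖∫ τ in Ioo s t, ((∫ y, f (τ, y)) - ∫ y, g (τ, y))‖ₑ
      ≤ ∫⁻ τ in Ioo s t, ‖(∫ y, f (τ, y)) - ∫ y, g (τ, y)‖ₑ := enorm_integral_le_lintegral_enorm _
    _ = ∫⁻ τ in Ioo s t, ‖∫ y, (f (τ, y) - g (τ, y))‖ₑ :=
        lintegral_congr_ae (hae.mono fun τ hτ => by dsimp only; rw [hτ])
    _ ≤ ∫⁻ τ in Ioo s t, ∫⁻ y, ‖f (τ, y) - g (τ, y)‖ₑ :=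
        lintegral_mono fun τ => enorm_integral_le_lintegral_enorm _
    _ ≤ ∫⁻ τ in Ioo s t, ∫⁻ y, ENNReal.ofReal (M ^ 2) * ENNReal.ofReal (m τ (x - y)) :=
        setLIntegral_mono' measurableSet_Ioo fun τ hτ => lintegral_mono fun y => hpt τ hτ y
    _ = ENNReal.ofReal (M ^ 2) * ∫⁻ τ in Ioo s t, ∫⁻ z, ENNReal.ofReal (m τ z) := by
        rw [← lintegral_const_mul' _ _ ENNReal.ofReal_ne_top]
        refine lintegral_congr fun τ => ?_
        rw [lintegral_const_mul' _ _ ENNReal.ofReal_ne_top,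
          lintegral_sub_left_eq_self (fun z => ENNReal.ofReal (m τ z)) x]

end Increment

/-! ### The uniform modulus of continuity -/

section Modulus

variable {ν : ℝ}

/-- **Uniform modulus of continuity in time of the Duhamel term of bounded fields** (the
qualitative `L^∞` content of KNSS 2009, (3.10): the mild solution of the Stokes problem with
bounded right-hand side `∂_k f_k` is parabolically Hölder, with a norm controlled by `‖f‖_∞`).
For `ν > 0`, `S > 0`, `M ≥ 0` and `ε > 0` there is `δ > 0` such that: for all fields `u, v`
jointly measurable on a slab `(s, T) × E` with `T - s ≤ S` and bounded by `M` there, all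
`s ≤ t ≤ t' ≤ T` with `t' - t ≤ δ`, and every point `x`,
`‖B^ν_s(u,v)(t')(x) - B^ν_s(u,v)(t)(x)‖ ≤ ε`. The modulus depends on the fields only through `M`
(and on `ν`, `S`, `E`): the late piece `B^ν_t(u,v)(t')` is `O(M²√(t'-t))`, the early increment is
at most `M² Ω_S(t'-t)`, `Ω_S(h) → 0` (`tendsto_lintegral_sum_norm_oseenKernel_sub`). [cite: KochNadirashviliSereginSverak2009, §3 (3.10) (arXiv:0709.3599 p. 6)] -/
theorem exists_forall_norm_oseenDuhamel_sub_le (hν : 0 < ν) {S : ℝ} (hS : 0 < S) {M : ℝ}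
    (hM : 0 ≤ M) {ε : ℝ} (hε : 0 < ε) :
    ∃ δ > 0, ∀ ⦃u v : ℝ → E → E⦄ ⦃s T : ℝ⦄, T - s ≤ S →
      AEStronglyMeasurable (uncurry u) ((volume : Measure (ℝ × E)).restrict (Ioo s T ×ˢ univ)) →
      AEStronglyMeasurable (uncurry v) ((volume : Measure (ℝ × E)).restrict (Ioo s T ×ˢ univ)) →
      (∀ τ ∈ Ioo s T, ∀ y, ‖u τ y‖ ≤ M) → (∀ τ ∈ Ioo s T, ∀ y, ‖v τ y‖ ≤ M) →
      ∀ ⦃t t' : ℝ⦄, s ≤ t → t ≤ t' → t' ≤ T → t' - t ≤ δ → ∀ x,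
        ‖oseenDuhamel ν s u v t' x - oseenDuhamel ν s u v t x‖ ≤ ε := by
  obtain ⟨Cs, hCs, hsup⟩ := exists_norm_oseenDuhamel_bounded_le (E := E)
  set e := stdOrthonormalBasis ℝ E with he
  -- the kernel increment functional `Ω_S`
  set ΩS : ℝ → ℝ≥0∞ := fun h => ∫⁻ σ in Ioo 0 S, ∫⁻ z, ENNReal.ofReal
    (∑ i, ∑ j, ‖oseenKernel (ν * (σ + h)) z (e i) (e j) - oseenKernel (ν * σ) z (e i) (e j)‖) with hΩS
  have hΩlim : Tendsto ΩS (𝓝[>] 0) (𝓝 0) := tendsto_lintegral_sum_norm_oseenKernel_sub hν hS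
  -- the thresholds
  set η : ℝ := ε / 2 / (M ^ 2 + 1) with hη
  have hη0 : 0 < η := by positivity
  have hev1 : ∀ᶠ h in 𝓝[>] (0 : ℝ), ΩS h < ENNReal.ofReal η :=
    hΩlim.eventually (gt_mem_nhds (ENNReal.ofReal_pos.2 hη0))
  have hev2 : ∀ᶠ h in 𝓝[>] (0 : ℝ), Cs * M ^ 2 * ν ^ (-(1 / 2 : ℝ)) * (2 * Real.sqrt h) < ε / 2 := by
    have hc : Continuous fun h : ℝ => Cs * M ^ 2 * ν ^ (-(1 / 2 : ℝ)) * (2 * Real.sqrt h) :=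
      continuous_const.mul (continuous_const.mul Real.continuous_sqrt)
    have h0 := hc.tendsto 0
    simp only [Real.sqrt_zero, mul_zero] at h0
    exact (h0.eventually (gt_mem_nhds (by positivity : (0 : ℝ) < ε / 2))).filter_mono
      nhdsWithin_le_nhds
  obtain ⟨δ₀, hδ₀, hgood⟩ := mem_nhdsGT_iff_exists_Ioo_subset.1 (hev1.and hev2)
  refine ⟨δ₀ / 2, half_pos hδ₀, fun u v s T hTS hu hv huM hvM t t' hst htt' ht'T hδ x => ?_⟩
  -- the late piece, from any intermediate initial time
  have hlate : ∀ r : ℝ, s ≤ r → r < t' → t' - r < δ₀ →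
      ‖oseenDuhamel ν r u v t' x‖ < ε / 2 := by
    intro r hsr hrt' hr
    have hb := hsup hν hrt' hM (fun τ hτ y => huM τ ⟨hsr.trans_lt hτ.1, hτ.2.trans_le ht'T⟩ y)
      (fun τ hτ y => hvM τ ⟨hsr.trans_lt hτ.1, hτ.2.trans_le ht'T⟩ y) x
    exact hb.trans_lt (hgood ⟨sub_pos.2 hrt', hr⟩).2
  rcases htt'.eq_or_lt with h | htt'_lt
  · subst h; simpa using hε.le
  have hh : t' - t < δ₀ := by linarith
  rcases hst.eq_or_lt with h | hst_lt
  · -- `t = s`: the early term vanishes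
    subst h
    rw [oseenDuhamel_eq_zero_of_le le_rfl x, sub_zero]
    linarith [hlate s le_rfl htt'_lt hh]
  -- `s < t < t'`: split at `t`
  have hsplit := oseenDuhamel_eq_indicator_add hν hu hv hM huM hvM hst htt' (hst_lt.trans htt'_lt)
    ht'T x
  -- the early increment
  set Ωst : ℝ≥0∞ := ∫⁻ τ in Ioo s t, ∫⁻ z, ENNReal.ofReal (∑ i, ∑ j,
      ‖oseenKernel (ν * (t' - τ)) z (e i) (e j) - oseenKernel (ν * (t - τ)) z (e i) (e j)‖) with hΩst
  have hΩle : Ωst ≤ ΩS (t' - t) := by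
    have heq : Ωst = ∫⁻ σ in Ioo 0 (t - s), ∫⁻ z, ENNReal.ofReal (∑ i, ∑ j,
        ‖oseenKernel (ν * (σ + (t' - t))) z (e i) (e j) - oseenKernel (ν * σ) z (e i) (e j)‖) := by
      rw [hΩst, ← setLIntegral_Ioo_reflect_sub s t (fun σ => ∫⁻ z, ENNReal.ofReal (∑ i, ∑ j,
        ‖oseenKernel (ν * (σ + (t' - t))) z (e i) (e j) - oseenKernel (ν * σ) z (e i) (e j)‖))]
      refine setLIntegral_congr_fun measurableSet_Ioo fun τ _ => ?_
      simp only [show t - τ + (t' - t) = t' - τ by ring]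
    rw [heq]
    exact lintegral_mono_set (Ioo_subset_Ioo_right (by linarith))
  have hinc := enorm_oseenDuhamel_increment_le hν hu hv hM huM hvM hst_lt htt' ht'T x
  have hinc' : ‖oseenDuhamel ν s ((Iio t).indicator u) ((Iio t).indicator v) t' x -
      oseenDuhamel ν s u v t x‖ ≤ M ^ 2 * η := by
    have h1 : ‖oseenDuhamel ν s ((Iio t).indicator u) ((Iio t).indicator v) t' x -
        oseenDuhamel ν s u v t x‖ₑ ≤ ENNReal.ofReal (M ^ 2 * η) := by
      refine hinc.trans ?_
      rw [ENNReal.ofReal_mul (sq_nonneg M)]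
      gcongr
      exact (hΩle.trans (hgood ⟨sub_pos.2 htt'_lt, hh⟩).1.le)
    rw [← ofReal_norm] at h1
    exact (ENNReal.ofReal_le_ofReal_iff (by positivity)).1 h1
  have hMη : M ^ 2 * η ≤ ε / 2 := by
    rw [hη]
    rw [show M ^ 2 * (ε / 2 / (M ^ 2 + 1)) = ε / 2 * (M ^ 2 / (M ^ 2 + 1)) by ring]
    have : M ^ 2 / (M ^ 2 + 1) ≤ 1 := by
      rw [div_le_one (by positivity)]; linarith
    calc ε / 2 * (M ^ 2 / (M ^ 2 + 1)) ≤ ε / 2 * 1 := by gcongr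
      _ = ε / 2 := mul_one _
  have hl := hlate t hst htt'_lt hh
  rw [hsplit]
  calc ‖oseenDuhamel ν s ((Iio t).indicator u) ((Iio t).indicator v) t' x +
        oseenDuhamel ν t u v t' x - oseenDuhamel ν s u v t x‖
      = ‖(oseenDuhamel ν s ((Iio t).indicator u) ((Iio t).indicator v) t' x -
          oseenDuhamel ν s u v t x) + oseenDuhamel ν t u v t' x‖ := by abel_nf
    _ ≤ ‖oseenDuhamel ν s ((Iio t).indicator u) ((Iio t).indicator v) t' x -
          oseenDuhamel ν s u v t x‖ + ‖oseenDuhamel ν t u v t' x‖ := norm_add_le _ _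
    _ ≤ ε := by linarith

end Modulus

end Literature.Analysis.FluidPDE

end
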